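import Literature.Barriers.CriticalPhenomena.LongRangeTrivialityOnZ3NoSlidingScale
import Literature.Barriers.CriticalPhenomena.LongRangeTrivialityOnZ3Wick
import Literature.Probability.LatticeModels.GaussianPairingBoundCouplings

/-!
# Discharge of `newman_gaussian_evenMoment_le` (Newman's Gaussian domination of even moments),
# the Gaussian upper bound `⟨σ_{x₁}⋯σ_{x₂ₙ}⟩_{Λ,J,0,β} ≤ 𝒢_n` for general pair interactions, and the
# barrier `LongRangeTrivialityOnZ3` from three facts

Sibling of `Literature/Barriers/CriticalPhenomena/LongRangeTrivialityOnZ3.lean` (barrier catalogue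
D-0021, sub-problem `Ising3DConformalLimit`).

1. `LongRangeTrivialityOnZ3Moments.lean` vendors as the named fact `newman_gaussian_evenMoment_le`
   Newman's inequality (Newman 1975, Theorem 5, eq. (2.8), with Theorem 1 and eq. (1.1)): for the
   finite-volume free-boundary zero-field Gibbs expectation `⟨·⟩_{Λ,J,0,β}` of a ferromagnetic pair
   interaction `J ≥ 0` on `ℤ^d` at `β ≥ 0` and `X = ∑_{x∈Λ} λ_x σ_x`, `λ ≥ 0`,
   `⟨X^{2m}⟩_{Λ,J,0,β} ≤ (2m)!/(2^m m!) ⟨X²⟩_{Λ,J,0,β}^m`. This file PROVES it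
   (`newman_gaussian_evenMoment_le_holds`): the finite-volume state `LongRangeIsing.expectIn J Λ β 0`
   is the pair-interaction Gibbs average `PairIsing.avg` of
   `Literature/Probability/LatticeModels/GaussianPairingBoundCouplings.lean` with the ordered-pair
   couplings `c_{a,b} = (β/2)J_{a,b} ≥ 0` on the finite set `↥Λ` (`expectIn_zero_eq_avg`; the
   printed Hamiltonian `-∑_{{x,y}⊂Λ} J_{x,y}σ_xσ_y` is half the ordered double sum), and that file
   proves Newman's Gaussian inequality for general nonnegative pair couplings on a finite set
   (`PairIsing.avg_spinMonomial_le_pairingSum`, `PairIsing.avg_pow_two_mul_le`, by reduction to the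
   tree's random-current pairing bound through the decoration transformation).
2. In the same way, **the Gaussian (upper) half of Aizenman's Proposition 12.1 / Panis's
   Proposition 4.6 in finite volume for a general pair interaction** —
   `⟨σ_{x₁}⋯σ_{x₂ₙ}⟩_{Λ,J,0,β} ≤ 𝒢_n[⟨σσ⟩_{Λ,J,0,β}](x)`, i.e. `0 ≤ 𝒢_{2n}[S₂] - S_{2n}`
   (Aizenman CDM 2020, Prop. 7.2, left inequality) — is PROVED (`LongRangeIsing.corrIn_le_pairingSum`),
   in the spelling (`corrIn`, `pairIn`) of the named fact
   `aizenman_pairInteraction_wickDeviation_le_finite` of `LongRangeTrivialityOnZ3Wick.lean`, of which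
   it is one of the two one-sided bounds.
3. **Assembly.** `LongRangeTrivialityOnZ3Wick.lean` found the moment display
   `panis_evenMoment_deviation_le` of `…Moments` MISSTATED (false as printed) and re-threaded the
   summation through the corrected display `panis_evenMoment_deviation_le_wick`, proved there from
   `aizenman_pairInteraction_wickDeviation_le_finite` (whose Gaussian majorant needs no separate
   Newman step); `LongRangeTrivialityOnZ3NoSlidingScale.lean` bounds `S(β,L,f)` on `ℤ³` without
   Theorem 3.18, MMS2 and `χ_L ≤ C₂L^{-d}Σ_L` being theorems (`…MMSWalk`, `…Susceptibility`).
   Combining the two (`panis_thm12_dim3_of_threeFacts`, **`LongRangeTrivialityOnZ3.of_threeFacts`**):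
   the barrier follows from THREE named facts — `aizenman_pairInteraction_wickDeviation_le_finite`
   (random currents: switching lemma, Aizenman 1982 Prop. 12.1), `panis_treeDiagramBound`
   (Aizenman 1982) and `panis_infraredBound_algebraic` (Panis 2023, Prop. 3.8).

## References

* C. M. Newman, *Inequalities for Ising models and field theories which obey the Lee–Yang
  theorem*, Comm. Math. Phys. 41 (1975) 1–9, Theorem 5, eq. (2.8) [Newman1975].
* C. M. Newman, *Gaussian correlation inequalities for ferromagnets*, Z. Wahrsch. verw. Gebiete 33
  (1975) 75–93, Theorem 3, eqs. (3.6)–(3.7) [Newman1975Gaussian] (read pp. 75–80).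
* M. Aizenman, *A geometric perspective on the scaling limits of critical Ising and φ⁴_d models*,
  in Current Developments in Mathematics 2020, Prop. 7.2 (left inequality `0 ≤ 𝒢_{2n}[S₂] - S_{2n}`)
  [AizenmanCDM2020] — cited through `LongRangeTrivialityOnZ3Wick.lean`.
* R. Panis, arXiv:2309.05797 (2023) = Ann. Probab. 54 (2026), Prop. 4.6 and proof of Theorem 5.5,
  pp. 21–22 [Panis2023Triviality].

## Tree anchors

`LongRangeIsing.expectIn`, `pairGibbsWeight`, `pairHamiltonian` (`LongRangeTrivialityOnZ3`),
`spinAt_glue_coe` (`GKSInequalities`), `PairIsing.avg`, `PairIsing.weight`,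
`PairIsing.avg_spinMonomial_le_pairingSum`, `PairIsing.avg_pow_two_mul_le`
(`GaussianPairingBoundCouplings`), `pairingSum_congr_of_eq` (`GaussianPairingBound`), `corrIn`, `pairIn`,
`panis_evenMoment_deviation_le_wick_of_finite`, `panis_mgfDeviation_le_ursellFourBoxSum_of_wick`
(`…Wick`), `panis_thm12_dim3_of_twoPoint_mms` (`…NoSlidingScale`), `panis_mms_two_point_monotone_holds`
(`…MMSWalk`), `panis_boxSusceptibility_le_blockVariance_of_mms` (`…Susceptibility`),
`LongRangeTrivialityOnZ3.of_thm12_dim3` (`…UrsellSum`).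
-/

noncomputable section

namespace Literature.Barriers.CriticalPhenomena

open Literature.Probability.LatticeModels Literature.Probability.Percolation Finset

namespace LongRangeIsing

variable {d : ℕ} (J : Site d → Site d → ℝ) (Λ : Finset (Site d)) (β : ℝ)

/-- The zero-field exponent `-βH_{Λ,J,0}(τ) = ∑_{a,b∈Λ} (β/2)J_{a,b} τ_aτ_b` as an ordered double sum
over the sites of `Λ`. [cite: Panis2023Triviality, §1.2.1 (H_{Λ,J,h})] -/
theorem neg_mul_pairHamiltonian_zero_glue (τ : ↥Λ → ℤˣ) :
    -β * pairHamiltonian J Λ 0 (glue Λ τ .free) =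
      ∑ a : ↥Λ, ∑ b : ↥Λ, β / 2 * J a b * (spinAt a τ * spinAt b τ) := by
  have hS : ∑ x ∈ Λ, ∑ y ∈ Λ, J x y * spinAt x (glue Λ τ .free) * spinAt y (glue Λ τ .free) =
      ∑ a : ↥Λ, ∑ b : ↥Λ, J a b * spinAt a τ * spinAt b τ := by
    rw [← Finset.sum_coe_sort Λ]
    refine Finset.sum_congr rfl fun a _ => ?_
    rw [← Finset.sum_coe_sort Λ]
    refine Finset.sum_congr rfl fun b _ => ?_
    rw [spinAt_glue_coe, spinAt_glue_coe]
  unfold pairHamiltonian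
  rw [zero_mul, sub_zero, hS, show -β * (-(∑ a : ↥Λ, ∑ b : ↥Λ, J a b * spinAt a τ * spinAt b τ) / 2) =
      β / 2 * ∑ a : ↥Λ, ∑ b : ↥Λ, J a b * spinAt a τ * spinAt b τ by ring, Finset.mul_sum]
  refine Finset.sum_congr rfl fun a _ => ?_
  rw [Finset.mul_sum]
  exact Finset.sum_congr rfl fun b _ => by ring

/-- The zero-field Gibbs weight of `LongRangeTrivialityOnZ3` is the pair-interaction weight
`PairIsing.weight` with ordered-pair couplings `(β/2)J_{a,b}` on `↥Λ`. [cite: Panis2023Triviality, §1.2.1 (⟨·⟩_{Λ,J,h,β})] -/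
theorem pairGibbsWeight_zero_eq_weight (τ : ↥Λ → ℤˣ) :
    pairGibbsWeight J Λ β 0 τ = PairIsing.weight (fun a b : ↥Λ => β / 2 * J a b) τ := by
  rw [pairGibbsWeight, PairIsing.weight, neg_mul_pairHamiltonian_zero_glue]

/-- **The finite-volume zero-field state as a pair-interaction Gibbs average**:
`⟨F⟩_{Λ,J,0,β} = PairIsing.avg ((β/2)J|_Λ) (F ∘ glue)` (hence also an instance of the tree's
`gksExpect`, `PairIsing.avg_eq_gksExpect`; cf. `expectIn_eq_gksExpect` of `…Proofs`).
[cite: Panis2023Triviality, §1.2.1 (⟨F⟩_{Λ,J,h,β})] -/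
theorem expectIn_zero_eq_avg (F : SpinConfig (Site d) → ℝ) :
    expectIn J Λ β 0 F = PairIsing.avg (fun a b : ↥Λ => β / 2 * J a b) (fun τ => F (glue Λ τ .free)) := by
  rw [expectIn, PairIsing.avg]
  simp_rw [pairGibbsWeight_zero_eq_weight]

/-- **The Gaussian inequality `⟨σ_{x₁}⋯σ_{x₂ₙ}⟩_{Λ,J,0,β} ≤ 𝒢_n[⟨σσ⟩_{Λ,J,0,β}](x₁,…,x₂ₙ)` for a
general ferromagnetic pair interaction on `ℤ^d` in finite volume** (`J ≥ 0`, `β ≥ 0`, points in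
`Λ`, repetitions allowed): the left (Gaussian, Newman) inequality `0 ≤ 𝒢_{2n}[S₂] - S_{2n}` of
Aizenman's Proposition 12.1 / CDM Prop. 7.2 = Panis's Proposition 4.6, i.e. one of the two
one-sided bounds packaged in `aizenman_pairInteraction_wickDeviation_le_finite` (`…Wick`), in its
spelling. From `PairIsing.avg_spinMonomial_le_pairingSum` for the couplings `(β/2)J_{a,b}` on `↥Λ`.
[cite: AizenmanCDM2020, Prop. 7.2 (left inequality)] [cite: Newman1975Gaussian, Theorem 3, eqs. (3.6)-(3.7)] -/
theorem corrIn_le_pairingSum (hJ : ∀ x y, 0 ≤ J x y) (hβ : 0 ≤ β) {n : ℕ} (x : Fin (2 * n) → Site d)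
    (hx : ∀ i, x i ∈ Λ) : corrIn J Λ β x ≤ pairingSum (pairIn J Λ β) n x := by
  set c : ↥Λ → ↥Λ → ℝ := fun a b => β / 2 * J a b with hc
  have hc0 : ∀ a b : ↥Λ, a ≠ b → 0 ≤ c a b := fun a b _ => mul_nonneg (div_nonneg hβ zero_le_two) (hJ _ _)
  set x' : Fin (2 * n) → ↥Λ := fun i => ⟨x i, hx i⟩ with hx'
  have hN : corrIn J Λ β x = PairIsing.avg c (spinMonomial x') := by
    rw [corrIn, expectIn_zero_eq_avg]
    congr 1
    funext τ
    exact Finset.prod_congr rfl fun i _ => spinAt_glue_coe τ .free (x' i)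
  have h2 : ∀ i j, pairIn J Λ β (x i) (x j) = PairIsing.avg c (spinPair (x' i) (x' j)) := by
    intro i j
    rw [pairIn, expectIn_zero_eq_avg]
    congr 1
    funext τ
    rw [spinPair, spinAt_glue_coe τ .free (x' i), spinAt_glue_coe τ .free (x' j)]
  rw [hN, pairingSum_congr_of_eq (pairIn J Λ β) (fun a b => PairIsing.avg c (spinPair a b)) n x x' h2]
  exact PairIsing.avg_spinMonomial_le_pairingSum c hc0 n x'

end LongRangeIsing

open LongRangeIsing

/-- **Discharge of `newman_gaussian_evenMoment_le`** (Newman 1975, Theorem 5, eq. (2.8)): for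
`J ≥ 0`, `β ≥ 0`, a finite `Λ ⊂ ℤ^d` and `λ ≥ 0`,
`⟨(∑_{x∈Λ}λ_xσ_x)^{2m}⟩_{Λ,J,0,β} ≤ (2m)!/(2^m m!) ⟨(∑_{x∈Λ}λ_xσ_x)²⟩_{Λ,J,0,β}^m` — the pair-interaction
Gaussian domination `PairIsing.avg_pow_two_mul_le` for the couplings `(β/2)J_{a,b} ≥ 0` on `↥Λ`.
[cite: Newman1975, Theorem 5, eq. (2.8) (with Theorem 1 and eq. (1.1))] -/
theorem newman_gaussian_evenMoment_le_holds : newman_gaussian_evenMoment_le := by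
  intro d J hJ β hβ Λ lam hlam m
  have hc : ∀ a b : ↥Λ, a ≠ b → 0 ≤ β / 2 * J a b := fun a b _ =>
    mul_nonneg (div_nonneg hβ zero_le_two) (hJ _ _)
  have hsum : ∀ τ : ↥Λ → ℤˣ, ∑ x ∈ Λ, lam x * spinAt x (glue Λ τ .free) = ∑ a : ↥Λ, lam a * spinAt a τ := by
    intro τ
    rw [← Finset.sum_coe_sort Λ]
    exact Finset.sum_congr rfl fun a _ => by rw [spinAt_glue_coe]
  rw [expectIn_zero_eq_avg, expectIn_zero_eq_avg]
  simp_rw [hsum]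
  exact PairIsing.avg_pow_two_mul_le _ hc (fun a : ↥Λ => lam a) (fun a => hlam _) m

/-- **Theorem 1.2 of Panis 2023 at `d = 3` from three facts**: granted the deviation from Wick's law
in finite volume (`aizenman_pairInteraction_wickDeviation_le_finite`, Aizenman's Prop. 12.1 /
Panis's Prop. 4.6 in pairing form), the tree diagram bound and the infrared bound for
`C₀|x|₁^{-d-α}`, the `d = 3` instance `panis_thm12_dim3` holds: the corrected moment display and the
summation of `…Wick` (`panis_mgfDeviation_le_ursellFourBoxSum_of_wick`), then the `S(β,L,f)` bound
of `…NoSlidingScale` (`panis_thm12_dim3_of_twoPoint_mms`) with MMS2 and `χ_L ≤ C₂L^{-d}Σ_L` proved.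
[cite: Panis2023Triviality, Theorem 1.2 (d = 3) = Theorem 5.5 + Remark 5.4 (pp. 21–22)] -/
theorem panis_thm12_dim3_of_threeFacts (h46 : aizenman_pairInteraction_wickDeviation_le_finite)
    (hT : panis_treeDiagramBound) (hI : panis_infraredBound_algebraic) : panis_thm12_dim3 :=
  panis_thm12_dim3_of_twoPoint_mms
    (panis_mgfDeviation_le_ursellFourBoxSum_of_wick (panis_evenMoment_deviation_le_wick_of_finite h46)) hT
    panis_mms_two_point_monotone_holds hI
    (panis_boxSusceptibility_le_blockVariance_of_mms panis_mms_two_point_monotone_holds)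

/-- **The barrier `LongRangeTrivialityOnZ3` from three named facts** — the deviation from Wick's law
in finite volume `aizenman_pairInteraction_wickDeviation_le_finite` (random currents), the tree
diagram bound `panis_treeDiagramBound` and the infrared bound `panis_infraredBound_algebraic` — all
other inputs of Panis's proof used by the tree (MMS2, `χ_L ≤ C₂L^{-d}Σ_L`, the corrected moment
display, the summation, the `β_c = 0` dodge) being theorems, and Theorem 3.18 and Newman's
inequality not being needed. [cite: Panis2023Triviality, Theorem 1.2 and proof of Theorem 5.5 (pp. 21–22)] -/
theorem LongRangeTrivialityOnZ3.of_threeFacts (h46 : aizenman_pairInteraction_wickDeviation_le_finite)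
    (hT : panis_treeDiagramBound) (hI : panis_infraredBound_algebraic) : LongRangeTrivialityOnZ3 :=
  LongRangeTrivialityOnZ3.of_thm12_dim3 (panis_thm12_dim3_of_threeFacts h46 hT hI)

end Literature.Barriers.CriticalPhenomena

end
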